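import Summits.Ventures.PercRepro.C026Forest
import Summits.Ventures.PercRepro.C026Class

/-!
# C-026 on every forest: the minor step and the probability form (mine-3 §13, Theorem 13.1) (p5, gen 7)

`C026Forest.lean` gives the class lemma `(CF)` on every forest for three distinct marks.  The probability form —
C-026 at every `p ∈ [0,1]^E` — follows from typer-2's antipodal principle (`quadForm_nonneg_of_minors`): the quadratic
form is a sum of full-cube class sums of the marked MINORS `G.minor u v` (contract the sure edges `v`, delete the
edges outside `u`, keep the free edges), each equal to `#OnePair − #Bad` (`cubeSumQuad_kernel26_eq`), i.e.
nonnegative iff `(CF)` holds on the minor.  So we need `(CF)` with arbitrary (possibly repeated) marks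
(`cf_of_eq_ab`, `cf_any`) and **a minor of a forest is a forest** (`IsForest.minor`): the leaf-in-every-subgraph
property passes from vertex deletions to edge subsets (`IsForest.leaf_of_edges`), and a leaf CLASS of the
contracted graph is found by peeling sure edges one at a time (`exists_leafClass`, through typer-1's
contraction lemma `conn_update_true_iff`).  **`c026_forest`** is C-026 at every `p` on every forest.
-/

namespace PercRepro

open Finset

namespace MultiGraph

variable {V E : Type*} (G : MultiGraph V E)

/-! ### `(CF)` with repeated marks -/

open Classical in
/-- `(CF)` with `a = b`: both sides count the configurations with `c ≁ a`, one in `S̄`, one in `S`. -/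
theorem cf_of_eq_ab [Fintype E] [DecidableEq E] (a c : V) : G.CF a a c := by
  unfold CF
  have h1 : (Finset.univ.filter fun S : Config E => G.Conn S a a ∧ G.IsCIso Sᶜ a a c) =
      Finset.univ.filter fun S : Config E => ¬ G.Conn Sᶜ a c := by
    apply Finset.filter_congr
    intro S _
    unfold IsCIso
    exact ⟨fun h => h.2.1, fun h => ⟨MultiGraph.Conn.refl G _ _, h, h⟩⟩
  have h2 : (Finset.univ.filter fun S : Config E => G.OnePair S a a c) =
      Finset.univ.filter fun S : Config E => ¬ G.Conn S a c := by
    apply Finset.filter_congr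
    intro S _
    unfold OnePair
    have hr := MultiGraph.Conn.refl G S a
    tauto
  rw [h1, h2]
  apply le_of_eq
  apply Finset.card_bij (fun S _ => Sᶜ)
  · intro S hS
    rw [Finset.mem_filter] at hS ⊢
    exact ⟨Finset.mem_univ _, hS.2⟩
  · intro S _ S' _ h
    exact compl_injective h
  · intro T hT
    rw [Finset.mem_filter] at hT
    refine ⟨Tᶜ, ?_, compl_compl T⟩
    rw [Finset.mem_filter, compl_compl]
    exact ⟨Finset.mem_univ _, hT.2⟩

open Classical in
/-- **`(CF)` on every forest, for every three marks** (repeated marks are the trivial cases). -/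
theorem cf_any [Fintype E] [DecidableEq E] (hF : G.IsForest) (a b c : V) : G.CF a b c := by
  by_cases hab : a = b
  · subst hab
    exact G.cf_of_eq_ab a c
  by_cases hac : a = c
  · subst hac
    exact G.cf_of_eq_left a b
  by_cases hbc : b = c
  · subst hbc
    exact G.cf_of_eq_right a b
  exact G.cf_forest hF hab hac hbc

/-! ### The leaf property on edge subsets -/

/-- **A forest has a leaf on every nonempty edge subset**: a vertex `x` with exactly one `F`-edge `f`, not a loop.
(Delete the vertices that carry no `F`-edge; the leaf of that sub-multigraph is a leaf of `F`.) -/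
theorem IsForest.leaf_of_edges (hF : G.IsForest) (F : Set E) {e₀ : E} (he₀ : e₀ ∈ F) :
    ∃ x f, f ∈ F ∧ (G.fst f = x ∨ G.snd f = x) ∧ G.fst f ≠ G.snd f ∧
      ∀ e ∈ F, (G.fst e = x ∨ G.snd e = x) → e = f := by
  classical
  -- the vertices carrying no `F`-edge
  set D : Set V := {z | ∀ e ∈ F, G.fst e ≠ z ∧ G.snd e ≠ z} with hD
  have hnotD : ∀ e ∈ F, G.fst e ∉ D ∧ G.snd e ∉ D := by
    intro e he
    constructor
    · intro h
      exact (h e he).1 rfl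
    · intro h
      exact (h e he).2 rfl
  obtain ⟨v, w, hv, hw, hvw, f, hf1, hf2, hf, huniq⟩ := hF D ⟨e₀, hnotD e₀ he₀⟩
  -- `v` carries an `F`-edge, which avoids `D`, hence is `f`
  have hvF : ∃ e ∈ F, G.fst e = v ∨ G.snd e = v := by
    by_contra hcon
    push Not at hcon
    exact hv fun e he => hcon e he
  obtain ⟨e, he, hev⟩ := hvF
  have hef : e = f := huniq e (hnotD e he).1 (hnotD e he).2 hev
  subst hef
  refine ⟨v, e, he, ?_, ?_, ?_⟩
  · rcases hf with ⟨h1, -⟩ | ⟨-, h2⟩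
    · exact Or.inl h1
    · exact Or.inr h2
  · rcases hf with ⟨h1, h2⟩ | ⟨h1, h2⟩
    · rw [h1, h2]; exact hvw
    · rw [h1, h2]; exact Ne.symm hvw
  · intro e' he' hev'
    exact huniq e' (hnotD e' he').1 (hnotD e' he').2 hev'

/-! ### Leaf classes: peeling the sure edges -/

/-- **A leaf class** of `(ω, F)`: a vertex `x` and an edge `g ∈ F` meeting the `ω`-cluster of `x` in exactly one
endpoint, such that no other edge of `F` meets that cluster. -/
def LeafClass (ω : Config E) (F : Set E) (x : V) (g : E) : Prop :=
  g ∈ F ∧ (G.Conn ω x (G.fst g) ∨ G.Conn ω x (G.snd g)) ∧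
    ¬ (G.Conn ω x (G.fst g) ∧ G.Conn ω x (G.snd g)) ∧
    ∀ g' ∈ F, (G.Conn ω x (G.fst g') ∨ G.Conn ω x (G.snd g')) → g' = g

/-- **Opening a pendant edge** `f = x–y` (no edge of `ω` open at `x`): `x' ↔ z` afterwards iff `x' ↔ z` before, or
`z = x` and `x' ↔ y` before, or `x' = x` and `y ↔ z` before (typer-1's contraction lemma). -/
theorem conn_update_pendant_iff [DecidableEq E] {ω : Config E} {f : E} {x y : V}
    (hf : (G.fst f = x ∧ G.snd f = y) ∨ (G.fst f = y ∧ G.snd f = x))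
    (hiso : ∀ e, ω e = true → G.fst e ≠ x ∧ G.snd e ≠ x) (x' z : V) :
    G.Conn (Function.update ω f true) x' z ↔
      G.Conn ω x' z ∨ (z = x ∧ G.Conn ω x' y) ∨ (x' = x ∧ G.Conn ω y z) := by
  have hx : ∀ u, G.Conn ω x u → u = x := fun u hu => G.eq_of_conn_of_isolated hiso hu
  rw [G.conn_update_true_iff]
  rcases hf with ⟨h1, h2⟩ | ⟨h1, h2⟩
  · rw [h1, h2]
    constructor
    · rintro (h | ⟨h1', h2'⟩ | ⟨h1', h2'⟩)
      · exact Or.inl h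
      · exact Or.inr (Or.inr ⟨hx x' h1'.symm, h2'⟩)
      · exact Or.inr (Or.inl ⟨hx z h2', h1'⟩)
    · rintro (h | ⟨hz, h⟩ | ⟨hx', h⟩)
      · exact Or.inl h
      · rw [hz]
        exact Or.inr (Or.inr ⟨h, MultiGraph.Conn.refl G ω x⟩)
      · rw [hx']
        exact Or.inr (Or.inl ⟨MultiGraph.Conn.refl G ω x, h⟩)
  · rw [h1, h2]
    constructor
    · rintro (h | ⟨h1', h2'⟩ | ⟨h1', h2'⟩)
      · exact Or.inl h
      · exact Or.inr (Or.inl ⟨hx z h2', h1'⟩)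
      · exact Or.inr (Or.inr ⟨hx x' h1'.symm, h2'⟩)
    · rintro (h | ⟨hz, h⟩ | ⟨hx', h⟩)
      · exact Or.inl h
      · rw [hz]
        exact Or.inr (Or.inl ⟨h, MultiGraph.Conn.refl G ω x⟩)
      · rw [hx']
        exact Or.inr (Or.inr ⟨MultiGraph.Conn.refl G ω x, h⟩)

omit G in
/-- The open edges after closing `f` are the open edges minus `f`. -/
theorem filter_update_false_eq [Fintype E] [DecidableEq E] (ω : Config E) (f : E) :
    (Finset.univ.filter fun e => Function.update ω f false e = true) =
      (Finset.univ.filter fun e => ω e = true).erase f := by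
  ext e
  simp only [Finset.mem_filter, Finset.mem_univ, true_and, Finset.mem_erase]
  by_cases he : e = f
  · subst he
    simp
  · rw [Function.update_of_ne he]
    exact ⟨fun h => ⟨he, h⟩, fun h => h.2⟩

/-- A leaf `x` of `F ∪ open(ω)` whose single edge `f` lies in `F` is a leaf class of `(ω, F)`: `x` is isolated
in `ω`, so its cluster is `{x}`. -/
theorem leafClass_of_leaf {ω : Config E} {F : Set E} {x : V} {f : E} (hfF : f ∈ F)
    (hfx : G.fst f = x ∨ G.snd f = x) (hff : G.fst f ≠ G.snd f)
    (huniq : ∀ e, e ∈ F ∪ {e | ω e = true} → (G.fst e = x ∨ G.snd e = x) → e = f) (hfω : ω f = false) :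
    G.LeafClass ω F x f := by
  have hiso : ∀ e, ω e = true → G.fst e ≠ x ∧ G.snd e ≠ x := by
    intro e he
    have hne : ¬ (G.fst e = x ∨ G.snd e = x) := by
      intro hex
      have := huniq e (Or.inr he) hex
      subst this
      rw [he] at hfω
      exact absurd hfω (by decide)
    exact ⟨fun h => hne (Or.inl h), fun h => hne (Or.inr h)⟩
  have hx : ∀ u, G.Conn ω x u → u = x := fun u hu => G.eq_of_conn_of_isolated hiso hu
  refine ⟨hfF, ?_, ?_, ?_⟩
  · rcases hfx with h | h
    · exact Or.inl (by rw [h]; exact MultiGraph.Conn.refl G ω x)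
    · exact Or.inr (by rw [h]; exact MultiGraph.Conn.refl G ω x)
  · rintro ⟨h1, h2⟩
    exact hff ((hx _ h1).trans (hx _ h2).symm)
  · intro g' hg' hcon
    apply huniq g' (Or.inl hg')
    rcases hcon with h | h
    · exact Or.inl (hx _ h)
    · exact Or.inr (hx _ h)

/-- **A forest has a leaf class on every nonempty set of closed edges**, for every configuration `ω` of open
(sure) edges: peel the open edges one at a time (`conn_update_pendant_iff`). -/
theorem exists_leafClass [Fintype E] [DecidableEq E] (hF : G.IsForest) :
    ∀ (n : ℕ) (ω : Config E), (Finset.univ.filter fun e => ω e = true).card = n →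
      ∀ F : Finset E, (∀ e ∈ F, ω e = false) → F.Nonempty → ∃ x g, G.LeafClass ω (F : Set E) x g := by
  intro n
  induction n with
  | zero =>
    intro ω hn F hFω ⟨e₀, he₀⟩
    obtain ⟨x, f, hfF, hfx, hff, huniq⟩ :=
      MultiGraph.IsForest.leaf_of_edges G hF ((F : Set E) ∪ {e | ω e = true}) (e₀ := e₀)
        (Or.inl (Finset.mem_coe.2 he₀))
    have hfω : ω f = false := by
      rcases hfF with h | h
      · exact hFω f (Finset.mem_coe.1 h)
      · exfalso
        have hmem : f ∈ Finset.univ.filter fun e => ω e = true := by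
          rw [Finset.mem_filter]; exact ⟨Finset.mem_univ _, h⟩
        rw [Finset.card_eq_zero] at hn
        rw [hn] at hmem
        exact Finset.notMem_empty _ hmem
    have hfF' : f ∈ (F : Set E) := by
      rcases hfF with h | h
      · exact h
      · exfalso
        have : ω f = true := h
        rw [hfω] at this
        exact absurd this (by decide)
    exact ⟨x, f, G.leafClass_of_leaf hfF' hfx hff huniq hfω⟩
  | succ n ih =>
    intro ω hn F hFω ⟨e₀, he₀⟩
    obtain ⟨x, f, hfF, hfx, hff, huniq⟩ :=
      MultiGraph.IsForest.leaf_of_edges G hF ((F : Set E) ∪ {e | ω e = true}) (e₀ := e₀)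
        (Or.inl (Finset.mem_coe.2 he₀))
    by_cases hfF' : f ∈ (F : Set E)
    · exact ⟨x, f, G.leafClass_of_leaf hfF' hfx hff huniq (hFω f (Finset.mem_coe.1 hfF'))⟩
    -- `f` is open: close it and peel
    have hfω : ω f = true := by
      rcases hfF with h | h
      · exact absurd h hfF'
      · exact h
    set ω' := Function.update ω f false with hω'
    have hcard : (Finset.univ.filter fun e => ω' e = true).card = n := by
      rw [hω', filter_update_false_eq ω f, Finset.card_erase_of_mem, hn]
      · rfl
      · rw [Finset.mem_filter]; exact ⟨Finset.mem_univ _, hfω⟩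
    have hFω' : ∀ e ∈ F, ω' e = false := by
      intro e he
      by_cases hef : e = f
      · rw [hef, hω', Function.update_self]
      · rw [hω', Function.update_of_ne hef]; exact hFω e he
    obtain ⟨x', g, hgF, hinc, hnot, huniq'⟩ := ih ω' hcard F hFω' ⟨e₀, he₀⟩
    -- `x` has no edge of `F` and no open edge of `ω'`
    have hxF : ∀ e ∈ F, ¬ (G.fst e = x ∨ G.snd e = x) := by
      intro e he hex
      have := huniq e (Or.inl (Finset.mem_coe.2 he)) hex
      subst this
      exact hfF' (Finset.mem_coe.2 he)
    have hiso : ∀ e, ω' e = true → G.fst e ≠ x ∧ G.snd e ≠ x := by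
      intro e he
      have hne : ¬ (G.fst e = x ∨ G.snd e = x) := by
        intro hex
        have hef : e ≠ f := by
          intro h
          rw [h, hω', Function.update_self] at he
          exact absurd he (by decide)
        rw [hω', Function.update_of_ne hef] at he
        have := huniq e (Or.inr he) hex
        exact hef this
      exact ⟨fun h => hne (Or.inl h), fun h => hne (Or.inr h)⟩
    -- the other endpoint `y` of `f`
    obtain ⟨y, hfy⟩ : ∃ y, (G.fst f = x ∧ G.snd f = y) ∨ (G.fst f = y ∧ G.snd f = x) := by
      rcases hfx with h | h
      · exact ⟨G.snd f, Or.inl ⟨h, rfl⟩⟩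
      · exact ⟨G.fst f, Or.inr ⟨rfl, h⟩⟩
    have hωeq : ω = Function.update ω' f true := by
      funext e
      by_cases hef : e = f
      · rw [hef, Function.update_self, hfω]
      · rw [Function.update_of_ne hef, hω', Function.update_of_ne hef]
    have hconn : ∀ z, G.Conn ω x' z ↔
        G.Conn ω' x' z ∨ (z = x ∧ G.Conn ω' x' y) ∨ (x' = x ∧ G.Conn ω' y z) := by
      intro z
      rw [hωeq]
      exact G.conn_update_pendant_iff hfy hiso x' z
    -- `x' ≠ x`: `x'`'s cluster meets an edge of `F`, and `x` has none
    have hx'x : x' ≠ x := by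
      intro h
      subst h
      rcases hinc with h1 | h1
      · exact hxF g hgF (Or.inl (G.eq_of_conn_of_isolated hiso h1))
      · exact hxF g hgF (Or.inr (G.eq_of_conn_of_isolated hiso h1))
    -- connections from `x'` to an endpoint of an edge of `F` are connections in `ω'`
    have hred : ∀ e ∈ F, ∀ z, (G.fst e = z ∨ G.snd e = z) → (G.Conn ω x' z ↔ G.Conn ω' x' z) := by
      intro e he z hez
      rw [hconn z]
      constructor
      · rintro (h | ⟨hz, -⟩ | ⟨hx'', -⟩)
        · exact h
        · exact absurd (by rw [← hz]; exact hez) (hxF e he)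
        · exact absurd hx'' hx'x
      · intro h
        exact Or.inl h
    refine ⟨x', g, hgF, ?_, ?_, ?_⟩
    · rcases hinc with h | h
      · exact Or.inl ((hred g hgF _ (Or.inl rfl)).2 h)
      · exact Or.inr ((hred g hgF _ (Or.inr rfl)).2 h)
    · rintro ⟨h1, h2⟩
      exact hnot ⟨(hred g hgF _ (Or.inl rfl)).1 h1, (hred g hgF _ (Or.inr rfl)).1 h2⟩
    · intro g' hg' hcon
      apply huniq' g' hg'
      rcases hcon with h | h
      · exact Or.inl ((hred g' hg' _ (Or.inl rfl)).1 h)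
      · exact Or.inr ((hred g' hg' _ (Or.inr rfl)).1 h)

/-! ### A minor of a forest is a forest -/

open Classical in
/-- **A minor of a forest is a forest**: the free edges whose classes avoid a set `D'` of classes form a set of
sure-closed edges of `G`; its leaf class for the sure configuration `v` (`exists_leafClass`) is a leaf of the minor
away from `D'`. -/
theorem IsForest.minor (hF : G.IsForest) [Fintype E] [DecidableEq E] (u v : Config E) :
    (G.minor u v).IsForest := by
  intro D' ⟨e₀, he₀1, he₀2⟩
  set F : Finset E := Finset.univ.filter fun g =>
    (v g = false ∧ u g = true) ∧ G.sureClass v (G.fst g) ∉ D' ∧ G.sureClass v (G.snd g) ∉ D' with hFdef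
  have hFv : ∀ g ∈ F, v g = false := fun g hg => ((Finset.mem_filter.1 hg).2.1).1
  have hne : F.Nonempty := ⟨e₀.1, by
    rw [hFdef, Finset.mem_filter]
    exact ⟨Finset.mem_univ _, e₀.2, he₀1, he₀2⟩⟩
  obtain ⟨x, g, hgF, hinc, hnot, huniq⟩ := G.exists_leafClass hF _ v rfl F hFv hne
  rw [Finset.mem_coe, hFdef, Finset.mem_filter] at hgF
  obtain ⟨-, hgfree, hg1, hg2⟩ := hgF
  have hmemF : ∀ e' : Face u v, (G.minor u v).fst e' ∉ D' → (G.minor u v).snd e' ∉ D' → e'.1 ∈ (F : Set E) := by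
    intro e' h1 h2
    rw [Finset.mem_coe, hFdef, Finset.mem_filter]
    exact ⟨Finset.mem_univ _, e'.2, h1, h2⟩
  rcases hinc with hx1 | hx2
  · -- the leaf class is `[fst g]`, the other end `[snd g]`
    refine ⟨G.sureClass v (G.fst g), G.sureClass v (G.snd g), hg1, hg2, ?_, ⟨g, hgfree⟩, hg1, hg2,
      Or.inl ⟨rfl, rfl⟩, ?_⟩
    · intro h
      exact hnot ⟨hx1, hx1.trans ((G.sureClass_eq_iff v _ _).1 h)⟩
    · intro e' he'1 he'2 he'x
      apply Subtype.ext
      apply huniq e'.1 (hmemF e' he'1 he'2)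
      rcases he'x with h | h
      · exact Or.inl (hx1.trans ((G.sureClass_eq_iff v _ _).1 h.symm))
      · exact Or.inr (hx1.trans ((G.sureClass_eq_iff v _ _).1 h.symm))
  · -- the leaf class is `[snd g]`, the other end `[fst g]`
    refine ⟨G.sureClass v (G.snd g), G.sureClass v (G.fst g), hg2, hg1, ?_, ⟨g, hgfree⟩, hg1, hg2,
      Or.inr ⟨rfl, rfl⟩, ?_⟩
    · intro h
      exact hnot ⟨hx2.trans ((G.sureClass_eq_iff v _ _).1 h), hx2⟩
    · intro e' he'1 he'2 he'x
      apply Subtype.ext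
      apply huniq e'.1 (hmemF e' he'1 he'2)
      rcases he'x with h | h
      · exact Or.inl (hx2.trans ((G.sureClass_eq_iff v _ _).1 h.symm))
      · exact Or.inr (hx2.trans ((G.sureClass_eq_iff v _ _).1 h.symm))

/-! ### C-026 at every `p` on every forest -/

open Classical in
/-- **C-026 on every forest, at every `p ∈ [0,1]^E` and every three marks** (mine-3 §13, Theorem 13.1): the
quadratic form of `kernel26` is a sum of class sums of the marked minors (`quadForm_nonneg_of_minors`), each the
count `#OnePair − #Bad` of a forest (`cubeSumQuad_kernel26_eq`, `IsForest.minor`), nonnegative by `cf_any`. -/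
theorem c026_forest [Fintype E] [DecidableEq E] (hF : G.IsForest) (p : E → ℝ) (hp : IsProb p) (a b c : V) :
    (G.law3 p a b c 0 + G.law3 p a b c 1) * (G.law3 p a b c 1 + G.law3 p a b c 4) ≤
      G.law3 p a b c 1 + G.law3 p a b c 2 + G.law3 p a b c 3 := by
  have h : 0 ≤ G.quadForm p ![a, b, c] kernel26 := by
    refine G.quadForm_nonneg_of_minors hp ![a, b, c] kernel26 fun u v _ => ?_
    have hm : (fun i => G.sureClass v (![a, b, c] i)) =
        ![G.sureClass v a, G.sureClass v b, G.sureClass v c] := by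
      funext i
      fin_cases i <;> rfl
    rw [hm, (G.minor u v).cubeSumQuad_kernel26_eq, sub_nonneg, Nat.cast_le]
    have := (G.minor u v).cf_any (MultiGraph.IsForest.minor G hF u v) (G.sureClass v a) (G.sureClass v b)
      (G.sureClass v c)
    unfold CF at this
    exact this
  rw [G.quadForm_kernel26] at h
  linarith

end MultiGraph

end PercRepro
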